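import Summits.HodgeConjecture.HodgeConjecture.Theorems.F0P3cStCharTSQuotientMassOpenSubgroup   -- ★ p851706 (J6a): `quotientMeasure_image_mul_measure_eq`; brings `quotientMeasure`
import HarnessLib

/-!
# F0 · P3c · line LH6 «StCharTS» — ROAD «JAC-LOC» brick (J6.5) «COSET IDENTITY»: a level-`η` orbit identity `Ad(K)(s·K_T) = s·P̃` and a mass identity
# `ν(P̃) = c · ν(K)` evaluate the radial measure on the torus coset `s·K_T`: `ν(Φ(A × s K_T)) = μ₀(A) · c · tm(s K_T)` for EVERY measurable `A ⊆ G ⧸ T`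
# (Harish-Chandra 1970 Lemma 22; Rogawski 1990 §12.5 p. 182)

Cell `pub/hodgecm-mathlib`, crux H413 = `stmt-HodgeConjecture-24833` (lane `--supports … --as helper`), route HCCMUnconditional; seat LH6-p03 (g5), holder of the
road «JAC-LOC» (memo `F0/P3b/LH6-p03/g5/ROAD-JAC-LOC.v3.LH6p03g5.md`; design note F0∕P3b 2026-09-02 «(J6) on the CM carrier, (J6-T) transports inputs»).
THEOREMS ONLY (no definition ∕ instance ∕ notation ∕ named fact ∕ `sorry`); GENERIC (any locally compact second countable group `G`, closed subgroup `H`,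
Haar `ν`, Haar-type `ρ` on `H`, the tree's `quotientMeasure`).  HONEST LABEL: count-neutral; closes no organ.  HC_CM is proved only modulo the 7 printed
citations (2 remaining: hLiu418 = `stmt-HodgeConjecture-24832`, h413 = `stmt-HodgeConjecture-24833`) until rung 0 closes; this is step (6.5) of the assembly
(J6) that discharges `hJacLoc` of ★ p851645 (hyperbolic half of the print residue «WIF» of the (S-𝔇) organ `stub_EllipticPackage` of
`Cruxes/H413/Lines/F0_P3c_StCharTSPaydown.lean`).

THE STEP.  Data: `Φ : (G ⧸ H) × H → G` with `Φ(xH, t) = x t x⁻¹`; a «radial» measure `σ` on `H` which EVALUATES TUBES over good sets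
(`hσ : ν(Φ(A × V)) = μ₀(A) · σ(V)` for measurable `A` and measurable good `V` — on `U(Φ₃)(L⁺_v)` this is ★ (J1) `exists_radialMeasure_tube` with «good» =
«regular and `W`-free»); an OPEN COMPACT subgroup `K ≤ G` (a congruence level `K_η ∩ U`), its torus trace `K_T = {t ∈ H | t ∈ K}`, a subgroup `P̃ ≤ G`
(the level-`η` sandwich), `s ∈ H` and a constant `c` (the Jacobian weight `D(s)`), with
* ORBIT IDENTITY `hOrb : {k s τ k⁻¹ | k ∈ K, τ ∈ K ∩ H} = s · P̃` (★ (J4c) p851809 ⊆ + ★ (J5c) p851835 ⊇, transported to the CM carrier by (J6-T)),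
* MASS IDENTITY `hP : ν(P̃) = c · ν(K)` ((J4b), transported).
THEN (§1 `measure_tube_coset_eq`): for EVERY measurable `A ⊆ G ⧸ H`, **`ν(Φ(A × s K_T)) = μ₀(A) · (c · ρ(s K_T))`** — provided `s K_T` is good.
PROOF.  `Φ(π(K) × s K_T) = {k s τ k⁻¹} = s P̃` (§0), so `μ₀(π K) · σ(s K_T) = ν(s P̃) = ν(P̃) = c · ν(K) = c · μ₀(π K) · ρ(K_T)` by ★ (J6a)
`μ₀(π K) · ρ(K_T) = ν(K)`; cancel `μ₀(π K) ∉ {0, ∞}` (`0 < ν(K) < ∞`, `ρ(K_T) > 0`): `σ(s K_T) = c · ρ(K_T) = c · ρ(s K_T)`; feed back into `hσ` for any `A`.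
§2 `measure_tube_coset_eq_lintegral`: the same with `c · ρ(s K_T)` rewritten `∫⁻_{s K_T} D dρ` when `D ≡ c` on `s K_T` (the shape of ★ p851761
`tubeJacobianLocal_of_piSystem`'s clause `∀ C ∈ 𝒞, ν (Φ '' (A₀ ×ˢ C)) = μ₀ A₀ * ∫⁻ t in C, D t ∂tm`).

## References
* [HarishChandra1970] Harish-Chandra, *Harmonic analysis on reductive p-adic groups*, LNM 162 (1970), Lemma 22 (the Jacobian of `(x, t) ↦ x t x⁻¹` is read on
  small open subgroups), Lemma 42.
* [Rogawski1990] J. D. Rogawski, *Automorphic Representations of Unitary Groups in Three Variables*, Ann. of Math. Stud. 123 (1990), §12.5 p. 182.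
* [Folland1995] G. B. Folland, *A Course in Abstract Harmonic Analysis* (1995), §2.6 Thm. 2.49 (quotient integral formula).
-/

set_option autoImplicit false
-- the mandated namespace has the single-problem summit's repeated segment (`HodgeConjecture.HodgeConjecture`)
set_option linter.dupNamespace false

noncomputable section

open MeasureTheory Measure Set
open Literature.MeasureTheory.Group
open Summit.HodgeConjecture.HodgeConjecture.Cruxes.H413.F0P3cStCharTSQuotientMassOpenSubgroup
open scoped ENNReal NNReal Pointwise

namespace Summit.HodgeConjecture.HodgeConjecture.Cruxes.H413.F0P3cStCharTSTubeCosetIdentity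

/-! ## §0 The tube over a torus coset is the orbit set -/

section Algebra

variable {G : Type*} [Group G] (H : Subgroup G)

/-- `Φ(π(K) × V) = {k t k⁻¹ | k ∈ K, t ∈ V}` for the conjugation family `Φ(xH, t) = x t x⁻¹`. [cite: HarishChandra1970, Lemma 22] -/
theorem image_conjFamily_mk_prod (Φ : (G ⧸ H) × H → G) (hΦ : ∀ (x : G) (t : H), Φ (QuotientGroup.mk x, t) = x * t * x⁻¹)
    (K : Set G) (V : Set H) :
    Φ '' ((QuotientGroup.mk '' K) ×ˢ V) = {x | ∃ k ∈ K, ∃ t ∈ V, k * (t : G) * k⁻¹ = x} := by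
  ext x
  constructor
  · rintro ⟨⟨q, t⟩, ⟨⟨k, hk, hq⟩, ht⟩, rfl⟩
    refine ⟨k, hk, t, ht, ?_⟩
    have hq' : (q, t) = (QuotientGroup.mk k, t) := by rw [hq]
    rw [hq', hΦ]
  · rintro ⟨k, hk, t, ht, rfl⟩
    exact ⟨(QuotientGroup.mk k, t), ⟨⟨k, hk, rfl⟩, ht⟩, hΦ k t⟩

/-- `{k t k⁻¹ | k ∈ K, t ∈ s·K_T} = {k s τ k⁻¹ | k ∈ K, τ ∈ K ∩ H}` (`K_T = {t ∈ H | t ∈ K}`). [cite: HarishChandra1970, Lemma 22] -/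
theorem setOf_conj_smul_eq (K : Set G) (s : H) :
    {x | ∃ k ∈ K, ∃ t ∈ s • {h : H | (h : G) ∈ K}, k * (t : G) * k⁻¹ = x} =
      {x | ∃ k ∈ K, ∃ τ ∈ K, τ ∈ H ∧ k * (s : G) * τ * k⁻¹ = x} := by
  ext x
  simp only [Set.mem_setOf_eq]
  constructor
  · rintro ⟨k, hk, t, ht, rfl⟩
    obtain ⟨τ, hτ, rfl⟩ := Set.mem_smul_set.mp ht
    refine ⟨k, hk, (τ : G), hτ, τ.2, ?_⟩
    rw [smul_eq_mul, Subgroup.coe_mul, mul_assoc k]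
  · rintro ⟨k, hk, τ, hτK, hτH, rfl⟩
    refine ⟨k, hk, s * ⟨τ, hτH⟩, Set.mem_smul_set.mpr ⟨⟨τ, hτH⟩, hτK, rfl⟩, ?_⟩
    simp only [Subgroup.coe_mul, mul_assoc]

/-- Hence, under the ORBIT IDENTITY `{k s τ k⁻¹ | k ∈ K, τ ∈ K ∩ H} = s · P̃`: **`Φ(π(K) × s K_T) = s · P̃`**. [cite: HarishChandra1970, Lemma 22] -/
theorem image_conjFamily_mk_prod_smul_eq (Φ : (G ⧸ H) × H → G) (hΦ : ∀ (x : G) (t : H), Φ (QuotientGroup.mk x, t) = x * t * x⁻¹)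
    (K : Set G) (P : Set G) (s : H) (hOrb : {x | ∃ k ∈ K, ∃ τ ∈ K, τ ∈ H ∧ k * (s : G) * τ * k⁻¹ = x} = (s : G) • P) :
    Φ '' ((QuotientGroup.mk '' K) ×ˢ (s • {h : H | (h : G) ∈ K})) = (s : G) • P := by
  rw [image_conjFamily_mk_prod H Φ hΦ, setOf_conj_smul_eq H K s, hOrb]

end Algebra

/-! ## §1 The coset identity -/

section Topology

variable {G : Type*} [Group G] [TopologicalSpace G] [IsTopologicalGroup G] (H : Subgroup G)

/-- The torus trace `K_T = {t ∈ H | t ∈ K}` of an open subgroup is open in `H`, and so is every coset `s · K_T`. [folklore] -/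
theorem isOpen_smul_trace (K : Subgroup G) (hKo : IsOpen (K : Set G)) (s : H) :
    IsOpen {h : H | (h : G) ∈ (K : Set G)} ∧ IsOpen (s • {h : H | (h : G) ∈ (K : Set G)}) := by
  have h1 : IsOpen {h : H | (h : G) ∈ (K : Set G)} := hKo.preimage continuous_subtype_val
  exact ⟨h1, h1.smul s⟩

end Topology

section Measure

variable {G : Type*} [Group G] [TopologicalSpace G] [IsTopologicalGroup G] [LocallyCompactSpace G]
  [SecondCountableTopology G] [T2Space G] [MeasurableSpace G] [BorelSpace G]
  (H : Subgroup G) (hH : IsClosed (H : Set G))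
  (ρ : Measure H) [ρ.IsMulLeftInvariant] [IsFiniteMeasureOnCompacts ρ] [ρ.IsOpenPosMeasure] [ρ.IsInvInvariant] [SFinite ρ]
  (ν : Measure G) [IsHaarMeasure ν] [ν.IsMulRightInvariant]
  [MeasurableSpace (G ⧸ H)] [BorelSpace (G ⧸ H)]

include hH in
/-- **`μ₀(π K) ∉ {0, ∞}`** for an open compact subgroup `K` (★ (J6a): `μ₀(π K) · ρ(K_T) = ν(K)` with `0 < ν(K) < ∞` and `ρ(K_T) > 0`).
[cite: Folland1995, §2.6 Thm. 2.49] -/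
theorem quotientMeasure_image_ne_zero_ne_top (K : Subgroup G) (hKo : IsOpen (K : Set G)) (hKc : IsCompact (K : Set G)) :
    quotientMeasure H ρ hH ν (QuotientGroup.mk '' (K : Set G)) ≠ 0 ∧ quotientMeasure H ρ hH ν (QuotientGroup.mk '' (K : Set G)) ≠ ∞ := by
  have hmass := quotientMeasure_image_mul_measure_eq H hH ρ ν K hKo
  have hνK0 : ν (K : Set G) ≠ 0 := hKo.measure_ne_zero ν ⟨1, K.one_mem⟩
  have hνKtop : ν (K : Set G) ≠ ∞ := hKc.measure_lt_top.ne
  have hρ0 : ρ {h : H | (h : G) ∈ (K : Set G)} ≠ 0 :=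
    (isOpen_smul_trace H K hKo 1).1.measure_ne_zero ρ ⟨1, by simp [K.one_mem]⟩
  refine ⟨?_, ?_⟩
  · intro h0
    rw [h0, zero_mul] at hmass
    exact hνK0 hmass.symm
  · intro htop
    rw [htop, ENNReal.top_mul hρ0] at hmass
    exact hνKtop hmass.symm

include hH in
/-- **(J6.5) «COSET IDENTITY».**  `Φ(xH, t) = x t x⁻¹`; `σ` evaluates tubes over good sets (`hσ`); `K ≤ G` open compact, `K_T = {t ∈ H | t ∈ K}`; ORBIT IDENTITY
`{k s τ k⁻¹ | k ∈ K, τ ∈ K ∩ H} = s · P̃` and MASS IDENTITY `ν(P̃) = c · ν(K)`.  Then for every measurable `A ⊆ G ⧸ H`, if `s K_T` is good,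
**`ν(Φ(A × s K_T)) = μ₀(A) · (c · ρ(s K_T))`** — the Jacobian of conjugation read on one torus coset. [cite: HarishChandra1970, Lemma 22]
[cite: Rogawski1990, §12.5 p. 182] -/
theorem measure_tube_coset_eq
    (Φ : (G ⧸ H) × H → G) (hΦ : ∀ (x : G) (t : H), Φ (QuotientGroup.mk x, t) = x * t * x⁻¹)
    (good : Set H → Prop) (σ : Measure H)
    (hσ : ∀ A : Set (G ⧸ H), MeasurableSet A → ∀ V : Set H, MeasurableSet V → good V →
      ν (Φ '' (A ×ˢ V)) = quotientMeasure H ρ hH ν A * σ V)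
    (K : Subgroup G) (hKo : IsOpen (K : Set G)) (hKc : IsCompact (K : Set G)) (P : Subgroup G) (s : H) (c : ℝ≥0∞)
    (hOrb : {x | ∃ k ∈ (K : Set G), ∃ τ ∈ (K : Set G), τ ∈ H ∧ k * (s : G) * τ * k⁻¹ = x} = (s : G) • (P : Set G))
    (hP : ν (P : Set G) = c * ν (K : Set G))
    (hgood : good (s • {h : H | (h : G) ∈ (K : Set G)})) :
    ∀ A : Set (G ⧸ H), MeasurableSet A →
      ν (Φ '' (A ×ˢ (s • {h : H | (h : G) ∈ (K : Set G)}))) =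
        quotientMeasure H ρ hH ν A * (c * ρ (s • {h : H | (h : G) ∈ (K : Set G)})) := by
  -- the coset is open, hence measurable; `π K` is open, hence measurable
  have hVo := (isOpen_smul_trace H K hKo s).2
  have hVm : MeasurableSet (s • {h : H | (h : G) ∈ (K : Set G)}) := hVo.measurableSet
  have hAKm : MeasurableSet (QuotientGroup.mk '' (K : Set G) : Set (G ⧸ H)) :=
    ((QuotientGroup.isOpenMap_coe (N := H)) _ hKo).measurableSet
  -- evaluate `σ(s K_T)` with `A = π K`
  have h1 := hσ _ hAKm _ hVm hgood
  rw [image_conjFamily_mk_prod_smul_eq H Φ hΦ (K : Set G) (P : Set G) s hOrb, measure_smul, hP] at h1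
  -- `c · ν K = c · μ₀(π K) · ρ(K_T)`
  have hmass := quotientMeasure_image_mul_measure_eq H hH ρ ν K hKo
  obtain ⟨hq0, hqtop⟩ := quotientMeasure_image_ne_zero_ne_top H hH ρ ν K hKo hKc
  have hσV : σ (s • {h : H | (h : G) ∈ (K : Set G)}) = c * ρ {h : H | (h : G) ∈ (K : Set G)} := by
    rw [← hmass] at h1
    -- h1 : c * (μ₀ πK * ρ K_T) = μ₀ πK * σ V
    have h2 : quotientMeasure H ρ hH ν (QuotientGroup.mk '' (K : Set G)) * σ (s • {h : H | (h : G) ∈ (K : Set G)}) =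
        quotientMeasure H ρ hH ν (QuotientGroup.mk '' (K : Set G)) * (c * ρ {h : H | (h : G) ∈ (K : Set G)}) := by
      rw [← h1]; ring
    exact (ENNReal.mul_right_inj hq0 hqtop).mp h2
  -- the coset has the same `ρ`-measure as `K_T`
  have hρV : ρ (s • {h : H | (h : G) ∈ (K : Set G)}) = ρ {h : H | (h : G) ∈ (K : Set G)} := measure_smul _ _ _
  intro A hA
  rw [hσ A hA _ hVm hgood, hσV, hρV]

include hH in
/-- **(J6.5) «COSET IDENTITY», integral form**: with `D ≡ c` on the coset `s K_T`, **`ν(Φ(A × s K_T)) = μ₀(A) · ∫⁻_{s K_T} D dρ`** — the clause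
`ν (Φ '' (A₀ ×ˢ C)) = μ₀ A₀ * ∫⁻ t in C, D t ∂tm` of ★ p851761 `tubeJacobianLocal_of_piSystem` on the coset `C = s K_T`. [cite: HarishChandra1970, Lemma 22]
[cite: Rogawski1990, §12.5 p. 182] -/
theorem measure_tube_coset_eq_lintegral
    (Φ : (G ⧸ H) × H → G) (hΦ : ∀ (x : G) (t : H), Φ (QuotientGroup.mk x, t) = x * t * x⁻¹)
    (good : Set H → Prop) (σ : Measure H)
    (hσ : ∀ A : Set (G ⧸ H), MeasurableSet A → ∀ V : Set H, MeasurableSet V → good V →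
      ν (Φ '' (A ×ˢ V)) = quotientMeasure H ρ hH ν A * σ V)
    (K : Subgroup G) (hKo : IsOpen (K : Set G)) (hKc : IsCompact (K : Set G)) (P : Subgroup G) (s : H)
    (D : H → ℝ≥0) (c : ℝ≥0) (hD : ∀ t ∈ s • {h : H | (h : G) ∈ (K : Set G)}, D t = c)
    (hOrb : {x | ∃ k ∈ (K : Set G), ∃ τ ∈ (K : Set G), τ ∈ H ∧ k * (s : G) * τ * k⁻¹ = x} = (s : G) • (P : Set G))
    (hP : ν (P : Set G) = (c : ℝ≥0∞) * ν (K : Set G))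
    (hgood : good (s • {h : H | (h : G) ∈ (K : Set G)}))
    (A : Set (G ⧸ H)) (hA : MeasurableSet A) :
    ν (Φ '' (A ×ˢ (s • {h : H | (h : G) ∈ (K : Set G)}))) =
      quotientMeasure H ρ hH ν A * ∫⁻ t in s • {h : H | (h : G) ∈ (K : Set G)}, (D t : ℝ≥0∞) ∂ρ := by
  have hVm : MeasurableSet (s • {h : H | (h : G) ∈ (K : Set G)}) := (isOpen_smul_trace H K hKo s).2.measurableSet
  have hint : ∫⁻ t in s • {h : H | (h : G) ∈ (K : Set G)}, (D t : ℝ≥0∞) ∂ρ = (c : ℝ≥0∞) * ρ (s • {h : H | (h : G) ∈ (K : Set G)}) := by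
    rw [← setLIntegral_const]
    exact setLIntegral_congr_fun hVm (fun t ht => by rw [hD t ht])
  rw [hint]
  exact measure_tube_coset_eq H hH ρ ν Φ hΦ good σ hσ K hKo hKc P s c hOrb hP hgood A hA

end Measure

end Summit.HodgeConjecture.HodgeConjecture.Cruxes.H413.F0P3cStCharTSTubeCosetIdentity

end
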